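import Summits.QuantumFields.YangMills.Theorems.BalabanUVNodesN15TwoGridCellLines
import HarnessLib

/-!
# N15 (NE2) — PROGRAMME M «MEAN-ZERO MULTIPLIERS», part M-B: THE CELL SWEEP AND ★★★ THE OSCILLATING PART OF ANY BOUNDED MULTIPLIER COSTS ONE RATE FACTOR
# BEHIND A SOURCE-DIVERGENCE LETTER — NO REGULARITY OF THE MULTIPLIER

WHO ∕ WHEN.  Cell `pub-ymgap`, seat `pub-ymgap-dag-n15-a` (KNIT-BY-NAME seat of Track-A DAG node N15 = NE2, g24); `--kind proof --supports stmt-QuantumFields-27366 --as helper` (K3⁸;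
count-neutral).  Over part M-A `…TwoGridCellLines` (`lineMean`, `linePrim`, `lineMean_lineMean`, `abs_lineMean_le`, `abs_linePrim_le`, `mulOp_comp_pull_eq_neg_divAdj_of_lineMean`,
`blockOf_linePt`) and the lineage's block-majorant vocabulary (`B11SectG.HasMaj`, `T4EtaRateCoeffDefect.pull ∕ diagK ∕ loc_fine_mul_pull_le`, `blkFine_comp_kingPrV`) BY NAME; nothing modified.
WHY.  See M-A: under [B9] (3.35) alone the zeroth-order coefficient of `Δ_U − Δ` is bounded with no modulus of continuity, so the lineage's POINTWISE two-grid fits for it are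
(3.36)-strength.  THIS FILE proves that no fit is needed for the CELL-OSCILLATING part: for ANY bounded fine multiplier `w` (`|w| ≤ ω`) and any operator `T′` with source-divergence
letters `T′∘∇′*_κ ≤ K` (all `κ`; (1.110) ∕ (3.42) entry 2 «G∇*» — in the tree for Bałaban's `Δ_a⁻¹` at `U ≡ 1`), `T′ ∘ M_{w − S̄w} ∘ P ≤ 2(d+1)·ω·L^{−k}·K`, where `S̄ = cellSweep (d+1)` is
the composite of the `d + 1` line means (the cell mean, M-C) and `P` King's prolongation.  What is left to FIT across `π` is only the CELL-CONSTANT part `S̄w` against the coarse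
coefficient — a comparison of cell MEANS, which (3.35) does control for `c = −∇*·a + O(a²)` (M-C∕M-E: face-average telescoping).
WHAT ([folklore]; one plumbing `def`).  §4 `cellSweep ℓ j` (`= lineMean_{j−1} ∘ ⋯ ∘ lineMean_0`, by recursion on `j`, constant for `j ≥ d + 1`): `cellSweep_zero ∕ _succ ∕ _succ_of_le`,
`lineMean_sweepPiece` (each telescoping piece `(cellSweep j − cellSweep (j+1))w` has ZERO `lineMean_j`), `sum_sweepPiece` (`Σ_{j<d+1} pieces = w − cellSweep (d+1) w`), `abs_cellSweep_le`
(`≤ ω`), `abs_sweepPiece_le` (`≤ 2ω`).  §5 `hasMaj_mulOp_comp_pull` (`M_g∘P ≤ diagK ω` from the coarse King blocks to the fine unit blocks), ★★ `hasMaj_comp_mulOp_pull_of_lineMean_zero`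
(`lineMean_κ g = 0`, `|g| ≤ ω`, `T′∘ρ′(n′(s_κ⁻¹−1)) ≤ K` ⟹ `T′∘(M_g∘P) ≤ ((L^m∕n′)·ω)·K`, `L^m∕n′ = L^{−k}`), ★★★ **`hasMaj_comp_mulOp_sub_cellSweep_pull`** (the display above).
HONEST FRAMING ∕ LIMITS.  Lattice algebra + block-majorant bookkeeping on the `U ≡ 1` torus MODEL carriers (King's pairing, unit blocks); the source-divergence letter is a HYPOTHESIS
(inhabited in the tree for `Δ_a⁻¹` at `U ≡ 1` by (1.110) entry 2, part 36 `hasMaj_gDivAdj_of_ineq`); no estimate of [B5]∕[B6]∕[B9] asserted; NE2⁺ NOT printed ∕ proved; no statement of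
record touched; N15 NOT discharged; K3⁸ OPEN; counts UNMOVED (typed 28∕28 · discharged 5∕27); one finite torus pair per index — NOT infinite volume ∕ OS ∕ mass gap ∕ Clay.
-/

open scoped BigOperators
open Finset

namespace Summit.QuantumFields.YangMills.BalabanUVNodes.N15.TwoGrid

open Literature.MathematicalPhysics.QuantumFieldTheory.Balaban1983to89
open Literature.MathematicalPhysics.QuantumFieldTheory.Balaban1983to89.B11SectG (BlockNorm HasMaj hasMaj_comp hasMaj_sum)
open Literature.MathematicalPhysics.QuantumFieldTheory.Balaban1983to89.B11AxialTransport190 (abs_le_loc_ofBlocks loc_ofBlocks_le)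
open Literature.MathematicalPhysics.QuantumFieldTheory.Balaban1983to89.T4EtaRateCoeffDefect (pull pull_apply diagK diagK_same diagK_ne diagK_nonneg loc_fine_mul_pull_le)
open Literature.MathematicalPhysics.QuantumFieldTheory.Balaban1983to89.B6Prop26Gluing (mulOp mulOp_apply)
open Literature.MathematicalPhysics.QuantumFieldTheory.Balaban1983to89.B5Prop11Plancherel (Tor fine unitVec)
open Literature.MathematicalPhysics.QuantumFieldTheory.King1986.Torus (blockOf)
open Literature.MathematicalPhysics.QuantumFieldTheory.Balaban1983to89.B6UnitTorusCarrier (unitTorusGeo)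
open Summit.QuantumFields.YangMills.BalabanUVNodes.N15.VectorPiece (blkFine kingPrV blkFine_comp_kingPrV)

variable {d : ℕ}

/-! ## §4 The cell sweep: `cellSweep j = lineMean_{j−1} ∘ ⋯ ∘ lineMean_0`, its telescoping pieces, their zero line means and their bounds -/

section Sweep

variable (M : Fin (d + 1) → ℕ) [∀ μ, NeZero (M μ)] (n : ℕ) [NeZero n] (ℓ : ℕ)

/-- **THE CELL SWEEP**: `cellSweep 0 = id`, `cellSweep (j+1) = lineMean_j ∘ cellSweep j` for `j < d + 1` (and constant afterwards); `cellSweep (d+1)` is the composite of all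
`d + 1` line means — the cell mean (M-C). [folklore] -/
noncomputable def cellSweep : ℕ → ((Tor (fine n M) × Fin (d + 1) → ℝ) →ₗ[ℝ] (Tor (fine n M) × Fin (d + 1) → ℝ))
  | 0 => LinearMap.id
  | j + 1 => if h : j < d + 1 then lineMean M n ℓ ⟨j, h⟩ ∘ₗ cellSweep j else cellSweep j

variable {ℓ}

omit [∀ μ, NeZero (M μ)] [NeZero n] in
/-- `cellSweep 0 = id`. [folklore] -/
@[simp] theorem cellSweep_zero : cellSweep M n ℓ 0 = LinearMap.id := rfl

omit [∀ μ, NeZero (M μ)] [NeZero n] in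
/-- the recursion step below `d + 1`. [folklore] -/
theorem cellSweep_succ {j : ℕ} (h : j < d + 1) : cellSweep M n ℓ (j + 1) = lineMean M n ℓ ⟨j, h⟩ ∘ₗ cellSweep M n ℓ j := by
  rw [cellSweep, dif_pos h]

omit [∀ μ, NeZero (M μ)] [NeZero n] in
/-- the sweep is constant from `d + 1` on. [folklore] -/
theorem cellSweep_succ_of_le {j : ℕ} (h : d + 1 ≤ j) : cellSweep M n ℓ (j + 1) = cellSweep M n ℓ j := by
  rw [cellSweep, dif_neg (not_lt.mpr h)]

/-- ★ **EACH TELESCOPING PIECE HAS ZERO LINE MEAN IN ITS OWN DIRECTION**: `lineMean_j ((cellSweep j − cellSweep (j+1)) w) = 0` (`ℓ ∣ n`; idempotency of `lineMean_j`). [folklore] -/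
theorem lineMean_sweepPiece (hℓn : ℓ ∣ n) {j : ℕ} (h : j < d + 1) (w : Tor (fine n M) × Fin (d + 1) → ℝ) :
    lineMean M n ℓ ⟨j, h⟩ (cellSweep M n ℓ j w - cellSweep M n ℓ (j + 1) w) = 0 := by
  rw [cellSweep_succ M n h, LinearMap.comp_apply, map_sub, lineMean_lineMean M n hℓn, sub_self]

omit [∀ μ, NeZero (M μ)] [NeZero n] in
/-- **THE TELESCOPING SUM**: `Σ_{j<d+1} (cellSweep j − cellSweep (j+1)) w = w − cellSweep (d+1) w`. [folklore] -/
theorem sum_sweepPiece (w : Tor (fine n M) × Fin (d + 1) → ℝ) :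
    ∑ j ∈ range (d + 1), (cellSweep M n ℓ j w - cellSweep M n ℓ (j + 1) w) = w - cellSweep M n ℓ (d + 1) w := by
  rw [Finset.sum_range_sub', cellSweep_zero, LinearMap.id_apply]

omit [∀ μ, NeZero (M μ)] [NeZero n] in
/-- the sweep does not increase a uniform bound: `|w| ≤ ω ⟹ |cellSweep j w| ≤ ω` (`0 < ℓ`). [folklore] -/
theorem abs_cellSweep_le (hℓ : 0 < ℓ) {w : Tor (fine n M) × Fin (d + 1) → ℝ} {ω : ℝ} (hw : ∀ z, |w z| ≤ ω) (j : ℕ) (z : Tor (fine n M) × Fin (d + 1)) :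
    |cellSweep M n ℓ j w z| ≤ ω := by
  induction j generalizing z with
  | zero => exact hw z
  | succ j ih =>
    by_cases h : j < d + 1
    · rw [cellSweep_succ M n h, LinearMap.comp_apply]
      exact abs_lineMean_le M n hℓ ⟨j, h⟩ fun i _ => ih _
    · rw [cellSweep_succ_of_le M n (not_lt.mp h)]
      exact ih z

omit [∀ μ, NeZero (M μ)] [NeZero n] in
/-- each telescoping piece is bounded by `2ω`. [folklore] -/
theorem abs_sweepPiece_le (hℓ : 0 < ℓ) {w : Tor (fine n M) × Fin (d + 1) → ℝ} {ω : ℝ} (hw : ∀ z, |w z| ≤ ω) (j : ℕ) (z : Tor (fine n M) × Fin (d + 1)) :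
    |(cellSweep M n ℓ j w - cellSweep M n ℓ (j + 1) w) z| ≤ 2 * ω := by
  rw [Pi.sub_apply]
  calc |cellSweep M n ℓ j w z - cellSweep M n ℓ (j + 1) w z| ≤ |cellSweep M n ℓ j w z| + |cellSweep M n ℓ (j + 1) w z| := abs_sub _ _
    _ ≤ ω + ω := add_le_add (abs_cellSweep_le M n hℓ hw j z) (abs_cellSweep_le M n hℓ hw (j + 1) z)
    _ = 2 * ω := by ring

omit [∀ μ, NeZero (M μ)] [NeZero n] in
/-- the oscillating part is bounded by `2ω` as well. [folklore] -/
theorem abs_sub_cellSweep_le (hℓ : 0 < ℓ) {w : Tor (fine n M) × Fin (d + 1) → ℝ} {ω : ℝ} (hw : ∀ z, |w z| ≤ ω) (j : ℕ) (z : Tor (fine n M) × Fin (d + 1)) :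
    |(w - cellSweep M n ℓ j w) z| ≤ 2 * ω := by
  rw [Pi.sub_apply]
  calc |w z - cellSweep M n ℓ j w z| ≤ |w z| + |cellSweep M n ℓ j w z| := abs_sub _ _
    _ ≤ ω + ω := add_le_add (hw z) (abs_cellSweep_le M n hℓ hw j z)
    _ = 2 * ω := by ring

end Sweep

/-! ## §5 ★★★ Block majorants: a bounded multiplier behind King's prolongation; the line-mean-zero and the cell-oscillating parts behind a source-divergence letter -/

section Majorants

variable {L : ℕ} [NeZero L] (M : Fin (d + 1) → ℕ) [∀ μ, NeZero (M μ)] (k m : ℕ) {F₂ : Type} [AddCommGroup F₂] [Module ℝ F₂]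

/-- **A BOUNDED FINE MULTIPLIER BEHIND KING's PROLONGATION**: `|g| ≤ ω` (`ω ≥ 0`) ⟹ `M_g ∘ P ≤ diagK ω` from the coarse 1-forms (King blocks `blkFine`) to the fine 1-forms (unit blocks
`blockOf`) — `P = pull (kingPrV L k m M)` keeps the unit block (`blkFine ∘ kingPrV = blockOf′`). [cite: King1986, p.664 (pairing convention «x′ ∈ B^n(x)»)] -/
theorem hasMaj_mulOp_comp_pull {g : Tor (fine (L ^ m * L ^ k) M) × Fin (d + 1) → ℝ} {ω : ℝ} (hω : 0 ≤ ω) (hg : ∀ z, |g z| ≤ ω) :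
    HasMaj (BlockNorm.ofBlocks (unitTorusGeo L k M) (blkFine L k M))
      (BlockNorm.ofBlocks (unitTorusGeo L k M) (fun i : Tor (fine (L ^ m * L ^ k) M) × Fin (d + 1) => blockOf (L ^ m * L ^ k) M i.1))
      (mulOp g ∘ₗ pull (kingPrV L k m M)) (diagK fun _ => ω) := by
  have hblk : (fun i : Tor (fine (L ^ m * L ^ k) M) × Fin (d + 1) => blockOf (L ^ m * L ^ k) M i.1) = blkFine L k M ∘ kingPrV L k m M :=
    (blkFine_comp_kingPrV M L k m).symm
  rw [hblk]
  intro y' μ hμ y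
  have hfun : (mulOp g ∘ₗ pull (kingPrV L k m M)) μ = fun x' => g x' * μ (kingPrV L k m M x') := funext fun x' => by
    rw [LinearMap.comp_apply, mulOp_apply, pull_apply]
  rw [hfun]
  exact loc_fine_mul_pull_le (g := unitTorusGeo L k M) (blkFine L k M) (kingPrV L k m M) (o := fun _ => ω) (fun _ => hω) (fun x' => hg x') hμ y

omit [NeZero L] in
/-- diagonal kernels collapse 𝔅-sums on the right (bookkeeping; cf. n15-b `DerivDefect.sum_mul_diagK`). [folklore] -/
theorem sum_mul_diagK_const (F : Tor M → ℝ) (ω : ℝ) (b : Tor M) : ∑ y'' : Tor M, F y'' * diagK (g := unitTorusGeo L k M) (fun _ => ω) y'' b = F b * ω := by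
  classical
  rw [Finset.sum_eq_single b]
  · rw [diagK_same]
  · intro y'' _ hy
    rw [diagK_ne _ hy, mul_zero]
  · intro hb
    exact absurd (Finset.mem_univ b) hb

/-- ★★ **A LINE-MEAN-ZERO MULTIPLIER BEHIND A SOURCE-DIVERGENCE LETTER COSTS ONE RATE FACTOR**: if `lineMean_κ g = 0` (cells of side `L^m` on the `η′ = L^{−m}η` torus), `|g| ≤ ω`, and
`T′∘ρ′(n′(s_κ⁻¹ − 1)) ≤ K` (`K ≥ 0`; Bałaban's «G∇*» shape), then `T′ ∘ (M_g ∘ P) ≤ ((L^m∕n′)·ω)·K` — and `L^m∕n′ = L^{−k}`.  M-A's exact divergence form + `abs_linePrim_le`; NO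
regularity of `g`. [cite: Balaban1984PropagatorsI, Prop. 1.2 (1.110) p.35 (the letter «G∇*J», shape); King1986, Prop. 3.9 (3.73) p.665 (rate factor)] -/
theorem hasMaj_comp_mulOp_pull_of_lineMean_zero {b₂ : BlockNorm (unitTorusGeo L k M) F₂} {T' : (Tor (fine (L ^ m * L ^ k) M) × Fin (d + 1) → ℝ) →ₗ[ℝ] F₂}
    {K : Tor M → Tor M → ℝ} (hK : ∀ y y', 0 ≤ K y y') (κ : Fin (d + 1)) {g : Tor (fine (L ^ m * L ^ k) M) × Fin (d + 1) → ℝ} {ω : ℝ} (hω : 0 ≤ ω)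
    (hg0 : lineMean M (L ^ m * L ^ k) (L ^ m) κ g = 0) (hg : ∀ z, |g z| ≤ ω)
    (hT : HasMaj (BlockNorm.ofBlocks (unitTorusGeo L k M) (fun i : Tor (fine (L ^ m * L ^ k) M) × Fin (d + 1) => blockOf (L ^ m * L ^ k) M i.1)) b₂
      (T' ∘ₗ symbOp M (L ^ m * L ^ k) (((L ^ m * L ^ k : ℕ) : ℝ) • (sTinv M (L ^ m * L ^ k) κ - 1))) K) :
    HasMaj (BlockNorm.ofBlocks (unitTorusGeo L k M) (blkFine L k M)) b₂ (T' ∘ₗ (mulOp g ∘ₗ pull (kingPrV L k m M)))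
      (fun y y' => ((L ^ m : ℕ) : ℝ) / ((L ^ m * L ^ k : ℕ) : ℝ) * ω * K y y') := by
  have hℓ0 : 0 < L ^ m := pow_pos (Nat.pos_of_ne_zero (NeZero.ne L)) m
  have hℓn : L ^ m ∣ L ^ m * L ^ k := Dvd.intro _ rfl
  -- the exact divergence form of M-A
  have hid : T' ∘ₗ (mulOp g ∘ₗ pull (kingPrV L k m M)) =
      -((T' ∘ₗ symbOp M (L ^ m * L ^ k) (((L ^ m * L ^ k : ℕ) : ℝ) • (sTinv M (L ^ m * L ^ k) κ - 1))) ∘ₗ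
        (mulOp (linePrim M (L ^ m * L ^ k) (L ^ m) κ g) ∘ₗ pull (kingPrV L k m M))) := by
    rw [mulOp_comp_pull_eq_neg_divAdj_of_lineMean M L k m κ hg0, LinearMap.comp_neg, LinearMap.comp_assoc]
  -- the antiderivative is small: `(L^m∕n′)·ω`
  have hprim : ∀ z, |linePrim M (L ^ m * L ^ k) (L ^ m) κ g z| ≤ ((L ^ m : ℕ) : ℝ) / ((L ^ m * L ^ k : ℕ) : ℝ) * ω := fun z =>
    abs_linePrim_le M (L ^ m * L ^ k) hℓ0 κ hω fun j _ => hg _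
  have hω' : 0 ≤ ((L ^ m : ℕ) : ℝ) / ((L ^ m * L ^ k : ℕ) : ℝ) * ω := mul_nonneg (by positivity) hω
  have hM := hasMaj_mulOp_comp_pull M k m hω' hprim
  rw [hid]
  refine ((hasMaj_comp hT hM hK).mono fun y y' => le_of_eq ?_).neg
  show ∑ y'' : Tor M, K y y'' * ((BlockNorm.ofBlocks (unitTorusGeo L k M) (fun i : Tor (fine (L ^ m * L ^ k) M) × Fin (d + 1) => blockOf (L ^ m * L ^ k) M i.1)).κ *
      diagK (g := unitTorusGeo L k M) (fun _ => ((L ^ m : ℕ) : ℝ) / ((L ^ m * L ^ k : ℕ) : ℝ) * ω) y'' y') = _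
  have hκ : (BlockNorm.ofBlocks (unitTorusGeo L k M) (fun i : Tor (fine (L ^ m * L ^ k) M) × Fin (d + 1) => blockOf (L ^ m * L ^ k) M i.1)).κ = 1 := rfl
  simp only [hκ, one_mul]
  rw [sum_mul_diagK_const]
  ring

/-- the rate factor `L^m∕(L^mL^k) = (L^k)⁻¹`. [folklore] -/
theorem cellRatio_eq : ((L ^ m : ℕ) : ℝ) / ((L ^ m * L ^ k : ℕ) : ℝ) = (((L ^ k : ℕ) : ℝ))⁻¹ := by
  have hL : (L : ℝ) ≠ 0 := Nat.cast_ne_zero.mpr (NeZero.ne L)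
  push_cast
  field_simp

/-- ★★★ **THE CELL-OSCILLATING PART OF ANY BOUNDED MULTIPLIER COSTS ONE RATE FACTOR BEHIND A SOURCE-DIVERGENCE LETTER** — NO REGULARITY OF THE MULTIPLIER.  If `|w| ≤ ω` and
`T′∘ρ′(n′(s_κ⁻¹ − 1)) ≤ K` for EVERY direction `κ` (`K ≥ 0`), then `T′ ∘ (M_{w − cellSweep (d+1) w} ∘ P) ≤ 2(d+1)·ω·(L^k)⁻¹·K`: the sweep's `d + 1` telescoping pieces each have zero
line mean in their own direction (`lineMean_sweepPiece`) and size `≤ 2ω`, so each is ★★ at `ω ↦ 2ω`.  What remains to be fitted across `π` is the CELL-CONSTANT part `cellSweep (d+1) w`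
only (M-C). [cite: Balaban1984PropagatorsI, Prop. 1.2 (1.110) p.35 (the letter «G∇*J», shape); King1986, Prop. 3.9 (3.73) p.665 (rate factor L^{−k})] -/
theorem hasMaj_comp_mulOp_sub_cellSweep_pull {b₂ : BlockNorm (unitTorusGeo L k M) F₂} {T' : (Tor (fine (L ^ m * L ^ k) M) × Fin (d + 1) → ℝ) →ₗ[ℝ] F₂}
    {K : Tor M → Tor M → ℝ} (hK : ∀ y y', 0 ≤ K y y') {w : Tor (fine (L ^ m * L ^ k) M) × Fin (d + 1) → ℝ} {ω : ℝ} (hω : 0 ≤ ω) (hw : ∀ z, |w z| ≤ ω)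
    (hT : ∀ κ : Fin (d + 1), HasMaj (BlockNorm.ofBlocks (unitTorusGeo L k M) (fun i : Tor (fine (L ^ m * L ^ k) M) × Fin (d + 1) => blockOf (L ^ m * L ^ k) M i.1)) b₂
      (T' ∘ₗ symbOp M (L ^ m * L ^ k) (((L ^ m * L ^ k : ℕ) : ℝ) • (sTinv M (L ^ m * L ^ k) κ - 1))) K) :
    HasMaj (BlockNorm.ofBlocks (unitTorusGeo L k M) (blkFine L k M)) b₂
      (T' ∘ₗ (mulOp (w - cellSweep M (L ^ m * L ^ k) (L ^ m) (d + 1) w) ∘ₗ pull (kingPrV L k m M)))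
      (fun y y' => 2 * (d + 1) * ω * (((L ^ k : ℕ) : ℝ))⁻¹ * K y y') := by
  have hℓ0 : 0 < L ^ m := pow_pos (Nat.pos_of_ne_zero (NeZero.ne L)) m
  have hℓn : L ^ m ∣ L ^ m * L ^ k := Dvd.intro _ rfl
  set p : ℕ → (Tor (fine (L ^ m * L ^ k) M) × Fin (d + 1) → ℝ) := fun j => cellSweep M (L ^ m * L ^ k) (L ^ m) j w - cellSweep M (L ^ m * L ^ k) (L ^ m) (j + 1) w with hp
  -- the operator is the sum of the `d + 1` piece operators
  have hsum : T' ∘ₗ (mulOp (w - cellSweep M (L ^ m * L ^ k) (L ^ m) (d + 1) w) ∘ₗ pull (kingPrV L k m M)) =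
      ∑ j ∈ range (d + 1), T' ∘ₗ (mulOp (p j) ∘ₗ pull (kingPrV L k m M)) := by
    refine LinearMap.ext fun φ => ?_
    rw [LinearMap.sum_apply, LinearMap.comp_apply]
    simp only [LinearMap.comp_apply]
    rw [← map_sum]
    congr 1
    funext z
    rw [Finset.sum_apply, mulOp_apply, pull_apply]
    simp only [mulOp_apply, pull_apply, ← Finset.sum_mul]
    rw [← Finset.sum_apply, sum_sweepPiece]
  rw [hsum]
  -- each piece: zero line mean in its own direction, size `2ω`
  have hpiece : ∀ j, HasMaj (BlockNorm.ofBlocks (unitTorusGeo L k M) (blkFine L k M)) b₂ (T' ∘ₗ (mulOp (p j) ∘ₗ pull (kingPrV L k m M)))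
      (fun y y' => if j < d + 1 then ((L ^ m : ℕ) : ℝ) / ((L ^ m * L ^ k : ℕ) : ℝ) * (2 * ω) * K y y' else 0) := by
    intro j
    by_cases hj : j < d + 1
    · simp only [if_pos hj]
      exact hasMaj_comp_mulOp_pull_of_lineMean_zero M k m hK ⟨j, hj⟩ (by positivity) (lineMean_sweepPiece M _ hℓn hj w) (abs_sweepPiece_le M _ hℓ0 hw j) (hT ⟨j, hj⟩)
    · simp only [if_neg hj]
      have hz : p j = 0 := by
        simp only [hp]
        rw [cellSweep_succ_of_le M _ (not_lt.mp hj), sub_self]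
      have h0 : T' ∘ₗ (mulOp (p j) ∘ₗ pull (kingPrV L k m M)) = 0 := by
        refine LinearMap.ext fun φ => ?_
        rw [LinearMap.comp_apply, LinearMap.comp_apply, hz, LinearMap.zero_apply]
        have : mulOp (0 : Tor (fine (L ^ m * L ^ k) M) × Fin (d + 1) → ℝ) (pull (kingPrV L k m M) φ) = 0 := funext fun z => by rw [mulOp_apply]; simp
        rw [this, map_zero]
      rw [h0]
      exact B11SectG.hasMaj_zero _ _
  refine (hasMaj_sum _ _ hpiece (d + 1)).mono fun y y' => le_of_eq ?_
  rw [Finset.sum_congr rfl fun j hj => if_pos (mem_range.mp hj), sum_const, card_range, nsmul_eq_mul, cellRatio_eq]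
  push_cast
  ring

end Majorants

end Summit.QuantumFields.YangMills.BalabanUVNodes.N15.TwoGrid
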